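import Literature.NumberTheory.LFunctions.ConreyCharacterSumsRH
import Literature.NumberTheory.LFunctions.CotangentCharacterSum
import Literature.NumberTheory.EllipticCurves.GaussSumJacobiChar
import Mathlib.NumberTheory.ZetaValues
import HarnessLib

/-!
# Conrey 2024, Theorem 4 / Corollary 1 — the finite form of `f_q`, PROVED (RH-FREE)

RH-FREE literature: a Fourier-series identity for the odd Jacobi character; it is NOT a
criterion, NOT a density statement, and says nothing about zeros of `ζ` — nothing here bears on
the truth of RH.  (The route crux `CharacterSums.ConreyPositivity` that Conrey's Theorem 3 would
have consumed is REFUTED in the kernel, `CharacterSumsConreyPositivity_refuted`; the present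
identity is independent of that and stays a theorem of the literature.)

Discharges the named fact `Conrey2024_corollary1` of `ConreyCharacterSumsRH.lean`:
for `q > 3` squarefree with `q ≡ 3 (mod 8)` and `x ≥ 0`,

  `f_q(x) = ∑_{n ≥ 1} (n/q) sin(2πnx)/n² = (2π²x/√q) (S_q(q/2) − S_q(qx))`,
  `S_q(N) = ∑_{n ≤ N} (n/q)(1 − n/N)`

[[cite: Conrey2024CharacterSums, Thm. 4 and Cor. 1 (§2 p. 4; proof §4 p. 6)]].  We prove it for
EVERY squarefree `q ≡ 3 (mod 4)` (`Conrey2024.fq_eq_finiteForm`; the paper's Remark 1: «We could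
just as well have stated this theorem for `q ≡ 3 mod 4`»), `q = 3` included, and then
`Conrey2024_corollary1_holds : Conrey2024_corollary1` by specialisation.

## Proof

The printed proof (§4, p. 6) moves a Mellin–Perron contour through the functional equation of
`L(s, χ_q)` (Lemmas 1, 3).  We take the equivalent ELEMENTARY road — the one the paper itself uses
on p. 9 («`L(1−r,θ) = −(m^{r−1}/r) ∑_b θ(b) B_r(b/m)` … `B₂(x) = x² − x + 1/6`») — in which the sign
of the functional equation enters as GAUSS'S SIGN of the quadratic Gauss sum, a tree theorem:

* **Part A (Gauss-sum inversion).** `χ = (·/q)` is the tree's `QuadraticFields.jacobiChar q`,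
  primitive (`isPrimitive_jacobiChar`) and quadratic; `τ(χ) = i√q` for squarefree `q ≡ 3 (mod 4)`
  (`EllipticCurves.ModularForms.gaussSum_jacobiChar_of_mod_four_eq_three`, Gauss's theorem with
  sign), and Mathlib's `gaussSum_mulShift_of_isPrimitive` (`∑_a χ(a) e(an/q) = χ̄(n) τ(χ)` for ALL
  `n`); imaginary parts give `(n/q) √q = ∑_{a<q} (a/q) sin(2πan/q)`
  (`jacobiSym_mul_sqrt_eq_sum_sin`).
* **Part B (Fourier series of `B₂`).** Mathlib's `hasSum_one_div_nat_pow_mul_cos` (`k = 1`),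
  made `1`-periodic: `∑_{n≥1} cos(2πnθ)/n² = π²({θ}² − {θ} + 1/6)` for every real `θ`
  (`hasSum_cos_div_sq_fract`; the `[0,1]` case is also `Literature.Analysis.Fourier.hasSum_cos_div_sq`),
  and `sin α sin β = (cos(α−β) − cos(α+β))/2`, whence
  `f_q(x) = (π²/2√q) ∑_{a<q} (a/q) [B₂({a/q − x}) − B₂({a/q + x})]` (`fq_eq_sum_fract`).
* **Part C.** `B₂∘{·}` is even and `χ` is odd, so the bracket collapses to
  `−2 ∑_{1≤a<q} (a/q) B₂({x + a/q})` (`sum_range_fract_eq`).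
* **Part D (a finite identity for odd `q`-periodic sequences `c`).** For `x ≥ 0`,
  `∑_{1≤a<q} c(a) B₂({x + a/q}) = −2x S + 2x ∑_{n ≤ qx} c(n) − (2/q) ∑_{n ≤ qx} n c(n)` with
  `S = ∑_{n ≤ q/2} c(n)(1 − 2n/q)` (`bernoulliSum_eq`): on `[0,1)` the fractional part wraps
  exactly for `a ≥ q − ⌊qx⌋` (`fract_add_div`), the polynomial part is evaluated with
  `∑ c = 0`, `∑ a c(a) = −qS`, `∑ a² c(a) = q ∑ a c(a)` (oddness), and the wrapped part reflects
  onto `[1, ⌊qx⌋]`; both sides are then `1`-periodic in `x` (`sum_Icc_add_period`,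
  `sum_Icc_mul_add_period`).  The identity `S_q(q/2) = −(1/q)∑_{a<q} a (a/q)` used here is the
  finite computation behind the paper's «`h(q) = S_q(q/2)`»; Dirichlet's class-number formula
  itself is not needed (as the base file's docstring anticipates).

No definitions, no named facts (D-0026): theorems only; closes `Conrey2024_corollary1` BY NAME.

## References

* [Conrey2024CharacterSums] J. B. Conrey, *Character sums and the Riemann Hypothesis*, Acta Arith.
  (2024), doi:10.4064/aa230530-13-11, arXiv:2404.19647 — Thm. 4, Cor. 1 (§2 p. 4), proof §4
  (p. 6), Remark 1 (p. 4), the `B₂` computation of §6 (p. 9); held text `paper:arxiv-2404.19647`.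
* [MontgomeryVaughan2007] H. L. Montgomery, R. C. Vaughan, *Multiplicative Number Theory I*,
  CUP 2007, Thm. 9.17 (the Gauss sum of a real primitive character, with sign).
-/

noncomputable section

open Finset Real Complex
open scoped NumberTheorySymbols

namespace Literature.NumberTheory.LFunctions

namespace Conrey2024.FiniteForm

open Literature.NumberTheory.QuadraticFields
open Literature.NumberTheory.EllipticCurves.ModularForms (gaussSum_jacobiChar_of_mod_four_eq_three)

variable {q : ℕ}

/-! ## Part A. Gauss-sum inversion for the odd Jacobi character -/

/-- **`(n/q)·√q = ∑_{a<q} (a/q) sin(2πan/q)`** for squarefree `q ≡ 3 (mod 4)` and every `n : ℕ`: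
the imaginary part of `∑_a χ(a) e(an/q) = χ(n) τ(χ)` (Mathlib `gaussSum_mulShift_of_isPrimitive`,
valid for all `n` by primitivity) with `τ(χ) = i√q` (Gauss's sign,
`gaussSum_jacobiChar_of_mod_four_eq_three`). [cite: MontgomeryVaughan2007, Theorem 9.17] -/
theorem jacobiSym_mul_sqrt_eq_sum_sin [NeZero q] (hsq : Squarefree q) (hq4 : q % 4 = 3) (n : ℕ) :
    (J((n : ℤ) | q) : ℝ) * Real.sqrt q =
      ∑ a ∈ range q, (J((a : ℤ) | q) : ℝ) * Real.sin (2 * π * n * ((a : ℝ) / q)) := by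
  have hodd : Odd q := Nat.odd_iff.mpr (by omega)
  have hprim := isPrimitive_jacobiChar hodd hsq
  have hquad := isQuadratic_jacobiChar (q := q)
  -- `Σ_a χ(a) e(na/q) = χ(n) τ(χ) = χ(n) i √q`
  have key := gaussSum_mulShift_of_isPrimitive (ZMod.stdAddChar (N := q)) hprim (n : ZMod q)
  rw [hquad.inv, gaussSum_jacobiChar_of_mod_four_eq_three hsq hq4, jacobiChar_natCast,
    gaussSum] at key
  -- the left sum as a sum over `range q`
  have hsum : ∑ a : ZMod q, jacobiChar q a * (ZMod.stdAddChar (N := q)).mulShift (n : ZMod q) a =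
      ∑ a ∈ range q,
        ((J((a : ℤ) | q) : ℂ) * Complex.exp (2 * π * I * ((n * a : ℕ) : ℤ) / q)) := by
    rw [← sum_zmod_val_eq_sum_range]
    refine Finset.sum_congr rfl fun a _ ↦ ?_
    rw [AddChar.mulShift_apply, jacobiChar_apply]
    congr 1
    rw [← ZMod.stdAddChar_coe, Int.cast_natCast, Nat.cast_mul, ZMod.natCast_zmod_val]
  rw [hsum] at key
  -- imaginary parts
  have him := congrArg Complex.im key
  rw [Complex.im_sum] at him
  have lhs : ∀ a ∈ range q,
      ((J((a : ℤ) | q) : ℂ) * Complex.exp (2 * π * I * ((n * a : ℕ) : ℤ) / q)).im =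
        (J((a : ℤ) | q) : ℝ) * Real.sin (2 * π * n * ((a : ℝ) / q)) := by
    intro a _
    rw [show (2 * π * I * ((n * a : ℕ) : ℤ) / q : ℂ) = ((2 * π * n * ((a : ℝ) / q) : ℝ) : ℂ) * I by
      push_cast; ring]
    rw [← Complex.ofReal_intCast, Complex.im_ofReal_mul, Complex.exp_ofReal_mul_I_im]
  rw [sum_congr rfl lhs] at him
  rw [him, ← Complex.ofReal_intCast, Complex.im_ofReal_mul]
  simp

/-! ## Part B. The Fourier series of `B₂` and the product-to-sum step -/

/-- **`∑_{n ≥ 1} cos(2πnθ)/n² = π²({θ}² − {θ} + 1/6)` for every real `θ`** — Mathlib's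
`hasSum_one_div_nat_pow_mul_cos` (`k = 1`, `B₂(x) = x² − x + 1/6` on `[0,1]`) made `1`-periodic
through `θ = {θ} + ⌊θ⌋` (the `[0,1]` statement is also `Literature.Analysis.Fourier.hasSum_cos_div_sq`).
[folklore] -/
private theorem hasSum_cos_div_sq_fract (θ : ℝ) :
    HasSum (fun n : ℕ ↦ Real.cos (2 * π * n * θ) / (n : ℝ) ^ 2)
      (π ^ 2 * (Int.fract θ ^ 2 - Int.fract θ + 1 / 6)) := by
  have hx : Int.fract θ ∈ Set.Icc (0 : ℝ) 1 := ⟨Int.fract_nonneg θ, (Int.fract_lt_one θ).le⟩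
  have h := hasSum_one_div_nat_pow_mul_cos one_ne_zero hx
  rw [show (Polynomial.map (algebraMap ℚ ℝ) (Polynomial.bernoulli (2 * 1))).eval (Int.fract θ) =
      bernoulliFun 2 (Int.fract θ) from rfl, bernoulliFun_two] at h
  have hf : (fun n : ℕ ↦ 1 / (n : ℝ) ^ (2 * 1) * Real.cos (2 * π * n * Int.fract θ)) =
      fun n : ℕ ↦ Real.cos (2 * π * n * θ) / (n : ℝ) ^ 2 := by
    funext n
    have hc : Real.cos (2 * π * n * Int.fract θ) = Real.cos (2 * π * n * θ) := by
      rw [← Int.self_sub_floor,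
        show 2 * π * n * (θ - ⌊θ⌋) = 2 * π * n * θ - ((n * ⌊θ⌋ : ℤ) : ℝ) * (2 * π) by
          push_cast; ring,
        Real.cos_sub_int_mul_two_pi]
    rw [hc]
    ring
  have hv : (-1 : ℝ) ^ (1 + 1) * (2 * π) ^ (2 * 1) / 2 / ((2 * 1).factorial : ℕ) *
      (Int.fract θ ^ 2 - Int.fract θ + 6⁻¹) = π ^ 2 * (Int.fract θ ^ 2 - Int.fract θ + 1 / 6) := by
    rw [show Nat.factorial (2 * 1) = 2 from rfl]
    push_cast
    ring
  rw [hf, hv] at h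
  exact h

/-- **`∑_{n ≥ 1} sin(2πnα) sin(2πnx)/n² = (π²/2)(B₂({α − x}) − B₂({α + x}))`**, from
`sin A sin B = (cos(A − B) − cos(A + B))/2` and `hasSum_cos_div_sq_fract`. [folklore] -/
private theorem hasSum_sin_mul_sin_div_sq (α x : ℝ) :
    HasSum (fun n : ℕ ↦ Real.sin (2 * π * n * α) * Real.sin (2 * π * n * x) / (n : ℝ) ^ 2)
      (π ^ 2 / 2 * ((Int.fract (α - x) ^ 2 - Int.fract (α - x) + 1 / 6)
        - (Int.fract (α + x) ^ 2 - Int.fract (α + x) + 1 / 6))) := by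
  have h := ((hasSum_cos_div_sq_fract (α - x)).sub (hasSum_cos_div_sq_fract (α + x))).div_const 2
  have hf : (fun n : ℕ ↦ (Real.cos (2 * π * n * (α - x)) / (n : ℝ) ^ 2 -
      Real.cos (2 * π * n * (α + x)) / (n : ℝ) ^ 2) / 2) =
      fun n : ℕ ↦ Real.sin (2 * π * n * α) * Real.sin (2 * π * n * x) / (n : ℝ) ^ 2 := by
    funext n
    have hc : Real.cos (2 * π * n * (α - x)) - Real.cos (2 * π * n * (α + x)) =
        2 * (Real.sin (2 * π * n * α) * Real.sin (2 * π * n * x)) := by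
      rw [mul_sub, mul_add, Real.cos_sub, Real.cos_add]
      ring
    rw [div_sub_div_same, hc]
    ring
  have hv : (π ^ 2 * (Int.fract (α - x) ^ 2 - Int.fract (α - x) + 1 / 6) -
      π ^ 2 * (Int.fract (α + x) ^ 2 - Int.fract (α + x) + 1 / 6)) / 2 =
      π ^ 2 / 2 * ((Int.fract (α - x) ^ 2 - Int.fract (α - x) + 1 / 6)
        - (Int.fract (α + x) ^ 2 - Int.fract (α + x) + 1 / 6)) := by ring
  rw [hf, hv] at h
  exact h

/-- **`f_q` as a finite sum of values of `B₂`**: for squarefree `q ≡ 3 (mod 4)` and every real `x`,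
`f_q(x) = (π²/(2√q)) ∑_{a<q} (a/q) [B₂({a/q − x}) − B₂({a/q + x})]` — insert Part A into the
absolutely convergent series `f_q` (base file `Conrey2024.fq`), exchange the finite sum with the
series (`hasSum_sum`) and apply `hasSum_sin_mul_sin_div_sq` termwise.
[cite: Conrey2024CharacterSums, Thm. 4 (§2 p. 4) and the B₂-computation of §6 (p. 9)] -/
theorem fq_eq_sum_fract [NeZero q] (hsq : Squarefree q) (hq4 : q % 4 = 3) (x : ℝ) :
    Conrey2024.fq q x = π ^ 2 / (2 * Real.sqrt q) *
      ∑ a ∈ range q, (J((a : ℤ) | q) : ℝ) *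
        ((Int.fract ((a : ℝ) / q - x) ^ 2 - Int.fract ((a : ℝ) / q - x) + 1 / 6)
          - (Int.fract ((a : ℝ) / q + x) ^ 2 - Int.fract ((a : ℝ) / q + x) + 1 / 6)) := by
  have hq0 : (0 : ℝ) < Real.sqrt q :=
    Real.sqrt_pos.mpr (by exact_mod_cast Nat.pos_of_ne_zero (NeZero.ne q))
  unfold Conrey2024.fq
  have hterm : ∀ n : ℕ, (J((n : ℤ) | q) : ℝ) * Real.sin (2 * π * n * x) / (n : ℝ) ^ 2 =
      ∑ a ∈ range q, (Real.sqrt q)⁻¹ * (J((a : ℤ) | q) : ℝ) *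
        (Real.sin (2 * π * n * ((a : ℝ) / q)) * Real.sin (2 * π * n * x) / (n : ℝ) ^ 2) := by
    intro n
    have h := jacobiSym_mul_sqrt_eq_sum_sin hsq hq4 n
    have hJ : (J((n : ℤ) | q) : ℝ) =
        (Real.sqrt q)⁻¹ * ∑ a ∈ range q, (J((a : ℤ) | q) : ℝ) * Real.sin (2 * π * n * ((a : ℝ) / q)) := by
      rw [← h]
      field_simp
    rw [hJ, Finset.mul_sum, Finset.sum_mul, Finset.sum_div]
    exact sum_congr rfl fun a _ ↦ by ring
  have hS := hasSum_sum (s := range q) fun a _ ↦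
    (hasSum_sin_mul_sin_div_sq ((a : ℝ) / q) x).mul_left ((Real.sqrt q)⁻¹ * (J((a : ℤ) | q) : ℝ))
  rw [show (fun n : ℕ ↦ (J((n : ℤ) | q) : ℝ) * Real.sin (2 * π * n * x) / (n : ℝ) ^ 2) =
      fun n : ℕ ↦ ∑ a ∈ range q, (Real.sqrt q)⁻¹ * (J((a : ℤ) | q) : ℝ) *
        (Real.sin (2 * π * n * ((a : ℝ) / q)) * Real.sin (2 * π * n * x) / (n : ℝ) ^ 2) from
      funext hterm, hS.tsum_eq, Finset.mul_sum]
  exact sum_congr rfl fun a _ ↦ by ring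

/-! ## Part D. A finite identity for odd `q`-periodic sequences

Throughout, `c : ℕ → ℝ` is "odd mod `q`" (`c (q − a) = −c a` for `a ≤ q`) and, where needed,
`q`-periodic; the application is `c n = (n/q)`. -/

variable {c : ℕ → ℝ}

/-- Reflection `a ↦ q − a` on `[1, q)`. [folklore] -/
private theorem sum_Ico_reflect (q : ℕ) (f : ℕ → ℝ) :
    ∑ a ∈ Ico 1 q, f (q - a) = ∑ a ∈ Ico 1 q, f a := by
  refine Finset.sum_nbij' (fun a ↦ q - a) (fun a ↦ q - a) ?_ ?_ ?_ ?_ ?_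
  · intro a ha; simp only [mem_Ico] at ha ⊢; omega
  · intro a ha; simp only [mem_Ico] at ha ⊢; omega
  · intro a ha; simp only [mem_Ico] at ha; omega
  · intro a ha; simp only [mem_Ico] at ha; omega
  · intro a _; rfl

/-- An odd `q`-periodic sequence vanishes at `0` and at `q`. [folklore] -/
private theorem apply_zero_of_odd (hodd : ∀ a ≤ q, c (q - a) = -c a) (hper : ∀ n, c (n + q) = c n) :
    c 0 = 0 ∧ c q = 0 := by
  have h1 := hodd 0 (Nat.zero_le _)
  have h2 := hper 0
  rw [Nat.sub_zero] at h1
  rw [zero_add] at h2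
  constructor <;> linarith

/-- `∑_{1 ≤ a < q} c(a) = 0` for `c` odd mod `q`. [folklore] -/
private theorem sum_eq_zero_of_odd (hodd : ∀ a ≤ q, c (q - a) = -c a) : ∑ a ∈ Ico 1 q, c a = 0 := by
  have h := sum_Ico_reflect q c
  rw [sum_congr rfl fun a ha ↦ hodd a (mem_Ico.mp ha).2.le, sum_neg_distrib] at h
  linarith

/-- `∑_{1 ≤ a < q} a² c(a) = q ∑_{1 ≤ a < q} a c(a)` for `c` odd mod `q` (reflect and use `∑ c = 0`).
[folklore] -/
private theorem sum_sq_mul_of_odd (hodd : ∀ a ≤ q, c (q - a) = -c a) :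
    ∑ a ∈ Ico 1 q, (a : ℝ) ^ 2 * c a = q * ∑ a ∈ Ico 1 q, (a : ℝ) * c a := by
  have h := sum_Ico_reflect q (fun a ↦ (a : ℝ) ^ 2 * c a)
  have h2 : ∑ a ∈ Ico 1 q, ((q - a : ℕ) : ℝ) ^ 2 * c (q - a) =
      ∑ a ∈ Ico 1 q, (-((q : ℝ) - a) ^ 2 * c a) := by
    refine sum_congr rfl fun a ha ↦ ?_
    have ha' := (mem_Ico.mp ha).2.le
    rw [hodd a ha', Nat.cast_sub ha']
    ring
  rw [h2] at h
  have h0 := sum_eq_zero_of_odd hodd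
  have key : ∑ a ∈ Ico 1 q, ((a : ℝ) ^ 2 * c a + ((q : ℝ) - a) ^ 2 * c a) = 0 := by
    rw [sum_add_distrib, ← h, ← sum_add_distrib]
    exact sum_eq_zero fun a _ ↦ by ring
  have key2 : ∑ a ∈ Ico 1 q, ((a : ℝ) ^ 2 * c a + ((q : ℝ) - a) ^ 2 * c a) =
      2 * ∑ a ∈ Ico 1 q, (a : ℝ) ^ 2 * c a - 2 * q * ∑ a ∈ Ico 1 q, (a : ℝ) * c a
        + (q : ℝ) ^ 2 * ∑ a ∈ Ico 1 q, c a := by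
    rw [mul_sum, mul_sum, mul_sum, ← sum_sub_distrib, ← sum_add_distrib]
    exact sum_congr rfl fun a _ ↦ by ring
  rw [key2, h0] at key
  linarith

/-- `⌊q/2⌋₊ = q / 2` (natural-number division). [folklore] -/
private theorem floor_natCast_div_two (q : ℕ) : ⌊(q : ℝ) / 2⌋₊ = q / 2 := by
  have := Nat.floor_div_eq_div (K := ℝ) q 2
  simpa using this

/-- **`∑_{1 ≤ a < q} a c(a) = −q · S`**, `S = ∑_{n ≤ q/2} c(n)(1 − n/(q/2))`, for `q` odd and `c` odd
mod `q`: split at `q/2` and reflect the upper half.  With `c = (·/q)` this is the finite identity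
`S_q(q/2) = −(1/q) ∑_{n=1}^{q} n (n/q)` behind the paper's «`h(q) = S_q(q/2)`».
[cite: Conrey2024CharacterSums, §2 p. 4 (display before Cor. 1)] -/
theorem sum_mul_of_odd (hq : Odd q) (hodd : ∀ a ≤ q, c (q - a) = -c a) :
    ∑ a ∈ Ico 1 q, (a : ℝ) * c a =
      -(q : ℝ) * ∑ n ∈ Icc 1 ⌊(q : ℝ) / 2⌋₊, c n * (1 - (n : ℝ) / ((q : ℝ) / 2)) := by
  obtain ⟨h, rfl⟩ := hq
  have hfl : ⌊((2 * h + 1 : ℕ) : ℝ) / 2⌋₊ = h := by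
    rw [floor_natCast_div_two]; omega
  rw [hfl]
  have hq0 : ((2 * h + 1 : ℕ) : ℝ) ≠ 0 := by positivity
  -- split `Ico 1 (2h+1)` at `h+1`
  rw [← sum_Ico_consecutive _ (show 1 ≤ h + 1 by omega) (show h + 1 ≤ 2 * h + 1 by omega)]
  -- reflect the top part onto `Ico 1 (h+1)`
  have htop : ∑ a ∈ Ico (h + 1) (2 * h + 1), (a : ℝ) * c a =
      ∑ n ∈ Ico 1 (h + 1), (-(((2 * h + 1 : ℕ) : ℝ) - n) * c n) := by
    symm
    refine Finset.sum_nbij' (fun n ↦ 2 * h + 1 - n) (fun a ↦ 2 * h + 1 - a) ?_ ?_ ?_ ?_ ?_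
    · intro a ha; simp only [mem_Ico] at ha ⊢; omega
    · intro a ha; simp only [mem_Ico] at ha ⊢; omega
    · intro a ha; simp only [mem_Ico] at ha; omega
    · intro a ha; simp only [mem_Ico] at ha; omega
    · intro n hn
      have hn' : n ≤ 2 * h + 1 := by simp only [mem_Ico] at hn; omega
      rw [hodd n hn', Nat.cast_sub hn']
      ring
  rw [htop, ← sum_add_distrib, Finset.Ico_add_one_right_eq_Icc, mul_sum]
  refine sum_congr rfl fun n _ ↦ ?_
  field_simp
  ring

/-- **Where `{x + a/q}` wraps.** For `0 ≤ x < 1` and `a < q`: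
`{x + a/q} = x + a/q − [q − ⌊qx⌋ ≤ a]`. [folklore] -/
private theorem fract_add_div {x : ℝ} (hx0 : 0 ≤ x) (hx1 : x < 1) {a : ℕ} (ha : a < q) :
    Int.fract (x + (a : ℝ) / q) =
      x + (a : ℝ) / q - if q - ⌊(q : ℝ) * x⌋₊ ≤ a then 1 else 0 := by
  have hq : (0 : ℝ) < q := by exact_mod_cast (Nat.zero_le a).trans_lt ha
  set m := ⌊(q : ℝ) * x⌋₊ with hm
  have hm1 : (m : ℝ) ≤ q * x := Nat.floor_le (by positivity)
  have hm2 : (q : ℝ) * x < m + 1 := Nat.lt_floor_add_one _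
  have hqx : (q : ℝ) * x < q := mul_lt_of_lt_one_right hq hx1
  have hmq : m < q := by exact_mod_cast (show (m : ℝ) < q by linarith)
  have haq : (a : ℝ) < q := by exact_mod_cast ha
  have hxa : x + (a : ℝ) / q = ((a : ℝ) + q * x) / q := by field_simp; ring
  rw [Int.fract_eq_iff]
  split_ifs with h
  · have h' : (q : ℝ) ≤ a + m := by exact_mod_cast (show q ≤ a + m by omega)
    refine ⟨?_, ?_, 1, ?_⟩
    · rw [hxa, sub_nonneg, le_div_iff₀ hq]; linarith
    · rw [hxa, sub_lt_iff_lt_add, div_lt_iff₀ hq]; linarith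
    · push_cast; ring
  · have h' : (a : ℝ) + m + 1 ≤ q := by exact_mod_cast (show a + m + 1 ≤ q by omega)
    refine ⟨?_, ?_, 0, ?_⟩
    · rw [sub_zero]; positivity
    · rw [sub_zero, hxa, div_lt_iff₀ hq]; linarith
    · push_cast; ring

/-- **The finite identity on `[0,1)`:** for `q` odd, `c` odd mod `q`, `0 ≤ x < 1`,
`∑_{1≤a<q} c(a) B₂({x + a/q}) = −2xS + 2x ∑_{n ≤ qx} c(n) − (2/q) ∑_{n ≤ qx} n c(n)`.
Proof: open the fractional parts with `fract_add_div`; the polynomial part is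
`(x² − x + 1/6)∑c + (2x − 1)/q · ∑ a c + (1/q²) ∑ a² c = −2xS` by the three oddness sums; the
wrapped part `∑_{q−⌊qx⌋ ≤ a < q} c(a)(2 − 2x − 2a/q)` reflects (`a = q − n`) onto `1 ≤ n ≤ ⌊qx⌋`.
[folklore] -/
private theorem bernoulliSum_eq_of_lt_one (hq : Odd q) (hodd : ∀ a ≤ q, c (q - a) = -c a) {x : ℝ} (hx0 : 0 ≤ x)
    (hx1 : x < 1) :
    ∑ a ∈ Ico 1 q, c a * (Int.fract (x + (a : ℝ) / q) ^ 2 - Int.fract (x + (a : ℝ) / q) + 1 / 6) =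
      -2 * x * (∑ n ∈ Icc 1 ⌊(q : ℝ) / 2⌋₊, c n * (1 - (n : ℝ) / ((q : ℝ) / 2)))
        + 2 * x * (∑ n ∈ Icc 1 ⌊(q : ℝ) * x⌋₊, c n)
        - 2 / q * (∑ n ∈ Icc 1 ⌊(q : ℝ) * x⌋₊, (n : ℝ) * c n) := by
  set m := ⌊(q : ℝ) * x⌋₊ with hm
  set S := ∑ n ∈ Icc 1 ⌊(q : ℝ) / 2⌋₊, c n * (1 - (n : ℝ) / ((q : ℝ) / 2)) with hS
  have hqpos : (0 : ℝ) < q := by exact_mod_cast hq.pos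
  have hq0 : (q : ℝ) ≠ 0 := hqpos.ne'
  have hm1 : (m : ℝ) ≤ q * x := Nat.floor_le (by positivity)
  have hqx : (q : ℝ) * x < q := mul_lt_of_lt_one_right hqpos hx1
  have hmq : m < q := by exact_mod_cast (show (m : ℝ) < q by linarith)
  -- Step 1: open the fractional parts
  have h1 : ∀ a ∈ Ico 1 q,
      c a * (Int.fract (x + (a : ℝ) / q) ^ 2 - Int.fract (x + (a : ℝ) / q) + 1 / 6) =
        c a * ((x + (a : ℝ) / q) ^ 2 - (x + (a : ℝ) / q) + 1 / 6) +
          (if q - m ≤ a then c a * (2 - 2 * x - 2 * (a : ℝ) / q) else 0) := by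
    intro a ha
    rw [fract_add_div hx0 hx1 (mem_Ico.mp ha).2]
    split_ifs <;> ring
  rw [sum_congr rfl h1, sum_add_distrib, ← sum_filter]
  -- Step 2: the polynomial part
  have h2 : ∑ a ∈ Ico 1 q, c a * ((x + (a : ℝ) / q) ^ 2 - (x + (a : ℝ) / q) + 1 / 6) =
      -2 * x * S := by
    have e : ∀ a ∈ Ico 1 q, c a * ((x + (a : ℝ) / q) ^ 2 - (x + (a : ℝ) / q) + 1 / 6) =
        (x ^ 2 - x + 1 / 6) * c a + (2 * x / q - 1 / q) * ((a : ℝ) * c a) +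
          (1 / (q : ℝ) ^ 2) * ((a : ℝ) ^ 2 * c a) := by
      intro a _
      field_simp
      ring
    rw [sum_congr rfl e, sum_add_distrib, sum_add_distrib, ← mul_sum, ← mul_sum, ← mul_sum,
      sum_eq_zero_of_odd hodd, sum_sq_mul_of_odd hodd, sum_mul_of_odd hq hodd, ← hS]
    field_simp
    ring
  -- Step 3: the wrapped part, reflected onto `[1, m]`
  have hfilter : (Ico 1 q).filter (fun a ↦ q - m ≤ a) = Ico (q - m) q := by
    ext a
    simp only [mem_filter, mem_Ico]
    omega
  have h3 : ∑ a ∈ (Ico 1 q).filter (fun a ↦ q - m ≤ a), c a * (2 - 2 * x - 2 * (a : ℝ) / q) =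
      2 * x * (∑ n ∈ Icc 1 m, c n) - 2 / q * (∑ n ∈ Icc 1 m, (n : ℝ) * c n) := by
    rw [hfilter]
    have hrefl : ∑ a ∈ Ico (q - m) q, c a * (2 - 2 * x - 2 * (a : ℝ) / q) =
        ∑ n ∈ Ico 1 (m + 1), c n * (2 * x - 2 * (n : ℝ) / q) := by
      symm
      refine Finset.sum_nbij' (fun n ↦ q - n) (fun a ↦ q - a) ?_ ?_ ?_ ?_ ?_
      · intro a ha; simp only [mem_Ico] at ha ⊢; omega
      · intro a ha; simp only [mem_Ico] at ha ⊢; omega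
      · intro a ha; simp only [mem_Ico] at ha; omega
      · intro a ha; simp only [mem_Ico] at ha; omega
      · intro n hn
        have hn' : n ≤ q := by simp only [mem_Ico] at hn; omega
        rw [hodd n hn', Nat.cast_sub hn']
        field_simp
        ring
    rw [hrefl, Finset.Ico_add_one_right_eq_Icc, mul_sum, mul_sum, ← sum_sub_distrib]
    refine sum_congr rfl fun n _ ↦ ?_
    ring
  rw [h2, h3]
  ring

/-- Full periods contribute nothing to `∑_{n ≤ N} c(n)` (`c` odd and `q`-periodic). [folklore] -/
private theorem sum_Icc_add_period (hodd : ∀ a ≤ q, c (q - a) = -c a) (hper : ∀ n, c (n + q) = c n)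
    (N : ℕ) : ∑ n ∈ Icc 1 (N + q), c n = ∑ n ∈ Icc 1 N, c n := by
  induction N with
  | zero =>
    rcases Nat.eq_zero_or_pos q with hq | hq
    · subst hq; simp
    · rw [zero_add, ← Finset.Ico_add_one_right_eq_Icc, Finset.sum_Ico_succ_top hq, sum_eq_zero_of_odd hodd,
        (apply_zero_of_odd hodd hper).2]
      simp
  | succ N ih =>
    rw [show N + 1 + q = (N + q) + 1 by ring, Finset.sum_Icc_succ_top (by omega),
      Finset.sum_Icc_succ_top (by omega), ih, show N + q + 1 = (N + 1) + q by ring, hper]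

/-- One full period of `∑_{n ≤ N} n c(n)`: `∑_{n ≤ N+q} n c(n) = ∑_{n ≤ N} n c(n) + q ∑_{n ≤ N} c(n) − qS`
(`c` odd and `q`-periodic, `q` odd). [folklore] -/
private theorem sum_Icc_mul_add_period (hq : Odd q) (hodd : ∀ a ≤ q, c (q - a) = -c a)
    (hper : ∀ n, c (n + q) = c n) (N : ℕ) :
    ∑ n ∈ Icc 1 (N + q), (n : ℝ) * c n =
      ∑ n ∈ Icc 1 N, (n : ℝ) * c n + q * ∑ n ∈ Icc 1 N, c n
        - q * ∑ n ∈ Icc 1 ⌊(q : ℝ) / 2⌋₊, c n * (1 - (n : ℝ) / ((q : ℝ) / 2)) := by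
  induction N with
  | zero =>
    rw [zero_add, ← Finset.Ico_add_one_right_eq_Icc, Finset.sum_Ico_succ_top hq.pos,
      sum_mul_of_odd hq hodd, (apply_zero_of_odd hodd hper).2]
    simp
  | succ N ih =>
    rw [show N + 1 + q = (N + q) + 1 by ring, Finset.sum_Icc_succ_top (by omega),
      Finset.sum_Icc_succ_top (by omega), Finset.sum_Icc_succ_top (by omega), ih,
      show N + q + 1 = (N + 1) + q by ring, hper]
    push_cast
    ring

/-- **The finite identity for all `x ≥ 0`** (`q` odd, `c` odd mod `q` and `q`-periodic):
`∑_{1≤a<q} c(a) B₂({x + a/q}) = −2xS + 2x ∑_{n ≤ qx} c(n) − (2/q) ∑_{n ≤ qx} n c(n)`.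
Both sides are `1`-periodic in `x` (left: `{· + 1} = {·}`; right: `⌊q(x+1)⌋ = ⌊qx⌋ + q` and the two
period lemmas), so `bernoulliSum_eq_of_lt_one` at `{x}` suffices (induction on `⌊x⌋`). [folklore] -/
private theorem bernoulliSum_eq (hq : Odd q) (hodd : ∀ a ≤ q, c (q - a) = -c a) (hper : ∀ n, c (n + q) = c n)
    {x : ℝ} (hx : 0 ≤ x) :
    ∑ a ∈ Ico 1 q, c a * (Int.fract (x + (a : ℝ) / q) ^ 2 - Int.fract (x + (a : ℝ) / q) + 1 / 6) =
      -2 * x * (∑ n ∈ Icc 1 ⌊(q : ℝ) / 2⌋₊, c n * (1 - (n : ℝ) / ((q : ℝ) / 2)))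
        + 2 * x * (∑ n ∈ Icc 1 ⌊(q : ℝ) * x⌋₊, c n)
        - 2 / q * (∑ n ∈ Icc 1 ⌊(q : ℝ) * x⌋₊, (n : ℝ) * c n) := by
  set S := ∑ n ∈ Icc 1 ⌊(q : ℝ) / 2⌋₊, c n * (1 - (n : ℝ) / ((q : ℝ) / 2)) with hS
  have hqpos : (0 : ℝ) < q := by exact_mod_cast hq.pos
  suffices H : ∀ k : ℕ, ∀ y : ℝ, 0 ≤ y → y < 1 →
      ∑ a ∈ Ico 1 q, c a *
          (Int.fract (y + k + (a : ℝ) / q) ^ 2 - Int.fract (y + k + (a : ℝ) / q) + 1 / 6) =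
        -2 * (y + k) * S + 2 * (y + k) * (∑ n ∈ Icc 1 ⌊(q : ℝ) * (y + k)⌋₊, c n)
          - 2 / q * (∑ n ∈ Icc 1 ⌊(q : ℝ) * (y + k)⌋₊, (n : ℝ) * c n) by
    have h := H ⌊x⌋₊ (Int.fract x) (Int.fract_nonneg x) (Int.fract_lt_one x)
    rwa [natCast_floor_eq_intCast_floor hx, Int.fract_add_floor] at h
  intro k
  induction k with
  | zero =>
    intro y hy0 hy1
    simpa using bernoulliSum_eq_of_lt_one hq hodd hy0 hy1
  | succ k ih =>
    intro y hy0 hy1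
    have hyk : 0 ≤ y + k := by positivity
    -- left side is `1`-periodic
    have hL : ∀ a ∈ Ico 1 q, c a *
        (Int.fract (y + ↑(k + 1) + (a : ℝ) / q) ^ 2 - Int.fract (y + ↑(k + 1) + (a : ℝ) / q) + 1 / 6) =
        c a * (Int.fract (y + k + (a : ℝ) / q) ^ 2 - Int.fract (y + k + (a : ℝ) / q) + 1 / 6) := by
      intro a _
      rw [show y + ↑(k + 1) + (a : ℝ) / q = (y + k + (a : ℝ) / q) + 1 by push_cast; ring,
        Int.fract_add_one]
    rw [sum_congr rfl hL, ih y hy0 hy1]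
    -- right side: peel one period
    have hfl : ⌊(q : ℝ) * (y + ↑(k + 1))⌋₊ = ⌊(q : ℝ) * (y + k)⌋₊ + q := by
      rw [show (q : ℝ) * (y + ↑(k + 1)) = (q : ℝ) * (y + k) + q by push_cast; ring]
      exact Nat.floor_add_natCast (by positivity) q
    rw [hfl, sum_Icc_add_period hodd hper, sum_Icc_mul_add_period hq hodd hper, ← hS]
    push_cast
    field_simp
    ring

/-! ## Part C. The Jacobi symbol as an odd periodic sequence; evenness of `B₂ ∘ {·}` -/

/-- `(q − a / q) = −(a/q)` for `a ≤ q` and `q ≡ 3 (mod 4)` (`(−1/q) = χ₄(q) = −1`,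
Mathlib `jacobiSym.neg`, `ZMod.χ₄_nat_three_mod_four`). [folklore] -/
private theorem jacobiSym_sub_eq_neg (hq4 : q % 4 = 3) {a : ℕ} (ha : a ≤ q) :
    (J(((q - a : ℕ) : ℤ) | q) : ℝ) = -(J((a : ℤ) | q) : ℝ) := by
  have hodd : Odd q := Nat.odd_iff.mpr (by omega)
  have h1 : J(((q - a : ℕ) : ℤ) | q) = J(-(a : ℤ) | q) := by
    rw [jacobiSym.mod_left, jacobiSym.mod_left (-(a : ℤ)), Nat.cast_sub ha,
      show (q : ℤ) - a = -(a : ℤ) + (q : ℤ) * 1 by ring, Int.add_mul_emod_self_left]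
  rw [h1, jacobiSym.neg _ hodd, ZMod.χ₄_nat_three_mod_four hq4]
  push_cast
  ring

/-- `(n + q / q) = (n/q)`. [folklore] -/
private theorem jacobiSym_add_period (n : ℕ) : (J(((n + q : ℕ) : ℤ) | q) : ℝ) = (J((n : ℤ) | q) : ℝ) := by
  rw [jacobiSym.mod_left, jacobiSym.mod_left (n : ℤ), Nat.cast_add,
    show (n : ℤ) + (q : ℤ) = n + (q : ℤ) * 1 by ring, Int.add_mul_emod_self_left]

/-- `B₂ ∘ {·}` is even: `{−u}² − {−u} = {u}² − {u}` (`{−u} = 1 − {u}` off the integers). [folklore] -/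
private theorem fract_sq_sub_fract_neg (u : ℝ) :
    Int.fract (-u) ^ 2 - Int.fract (-u) = Int.fract u ^ 2 - Int.fract u := by
  rcases eq_or_ne (Int.fract u) 0 with h | h
  · rw [h, Int.fract_neg_eq_zero.mpr h]
  · rw [Int.fract_neg h]
    ring

/-- **Part C:** for `q ≡ 3 (mod 4)`, `q > 1` and every real `x`,
`∑_{a<q} (a/q)[B₂({a/q − x}) − B₂({a/q + x})] = −2 ∑_{1≤a<q} (a/q) B₂({x + a/q})` — the `a = 0`
term vanishes, `B₂({a/q − x}) = B₂({x + (q−a)/q})` by evenness and `1`-periodicity, and the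
reflection `a ↦ q − a` flips the sign of the odd character. [folklore] -/
private theorem sum_range_fract_eq (hq4 : q % 4 = 3) (hq1 : 1 < q) (x : ℝ) :
    ∑ a ∈ range q, (J((a : ℤ) | q) : ℝ) *
        ((Int.fract ((a : ℝ) / q - x) ^ 2 - Int.fract ((a : ℝ) / q - x) + 1 / 6)
          - (Int.fract ((a : ℝ) / q + x) ^ 2 - Int.fract ((a : ℝ) / q + x) + 1 / 6)) =
      -2 * ∑ a ∈ Ico 1 q, (J((a : ℤ) | q) : ℝ) *
        (Int.fract (x + (a : ℝ) / q) ^ 2 - Int.fract (x + (a : ℝ) / q) + 1 / 6) := by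
  have hq0 : (q : ℝ) ≠ 0 := by positivity
  -- drop `a = 0`
  rw [Finset.range_eq_Ico, Finset.sum_eq_sum_Ico_succ_bot (by omega : 0 < q), Nat.cast_zero,
    jacobiSym.zero_left hq1, Int.cast_zero, zero_mul, zero_add, zero_add]
  -- the first half reflects onto the second
  have hfirst : ∑ a ∈ Ico 1 q, (J((a : ℤ) | q) : ℝ) *
      (Int.fract ((a : ℝ) / q - x) ^ 2 - Int.fract ((a : ℝ) / q - x) + 1 / 6) =
      ∑ a ∈ Ico 1 q, -((J((a : ℤ) | q) : ℝ) *
        (Int.fract (x + (a : ℝ) / q) ^ 2 - Int.fract (x + (a : ℝ) / q) + 1 / 6)) := by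
    rw [← sum_Ico_reflect q (fun a ↦ -((J((a : ℤ) | q) : ℝ) *
        (Int.fract (x + (a : ℝ) / q) ^ 2 - Int.fract (x + (a : ℝ) / q) + 1 / 6)))]
    refine sum_congr rfl fun a ha ↦ ?_
    have ha' : a ≤ q := (mem_Ico.mp ha).2.le
    rw [jacobiSym_sub_eq_neg hq4 ha', Nat.cast_sub ha', neg_mul, neg_neg]
    congr 1
    -- `{a/q - x}` versus `{x + (q - a)/q} = {-(a/q - x)}`
    have e : x + ((q : ℝ) - a) / q = -((a : ℝ) / q - x) + 1 := by field_simp; ring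
    rw [e, Int.fract_add_one, fract_sq_sub_fract_neg]
  have hsecond : ∀ a ∈ Ico 1 q, (a : ℝ) / q + x = x + (a : ℝ) / q := fun a _ ↦ add_comm _ _
  rw [sum_congr rfl fun a ha ↦ by rw [hsecond a ha, mul_sub], Finset.sum_sub_distrib, hfirst,
    sum_neg_distrib]
  ring

/-! ## Assembly -/

/-- `x · S_q(qx) = x ∑_{n ≤ qx} (n/q) − (1/q) ∑_{n ≤ qx} n (n/q)` for `x ≥ 0` (both sides vanish at
`x = 0`). [cite: Conrey2024CharacterSums, §2 p. 4 (definition of S_q) and p. 10 (display in the proof of Prop. 1)] -/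
theorem mul_S_eq (hq : 0 < q) {x : ℝ} (hx : 0 ≤ x) :
    x * Conrey2024.S q (q * x) =
      x * (∑ n ∈ Icc 1 ⌊(q : ℝ) * x⌋₊, (J((n : ℤ) | q) : ℝ))
        - 1 / q * ∑ n ∈ Icc 1 ⌊(q : ℝ) * x⌋₊, (n : ℝ) * (J((n : ℤ) | q) : ℝ) := by
  unfold Conrey2024.S
  rcases hx.eq_or_lt with h0 | hpos
  · subst h0
    simp
  · have hqx : (q : ℝ) * x ≠ 0 := by positivity
    rw [Finset.mul_sum, Finset.mul_sum, Finset.mul_sum, ← Finset.sum_sub_distrib]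
    refine sum_congr rfl fun n _ ↦ ?_
    field_simp

end Conrey2024.FiniteForm

open Conrey2024.FiniteForm in
/-- **Conrey 2024, Theorem 4 / Corollary 1, for every squarefree `q ≡ 3 (mod 4)` (Remark 1) and
`x ≥ 0`: `f_q(x) = (2π²x/√q)(S_q(q/2) − S_q(qx))`** (`q = 3` included).  Proof: Parts A–D of this
file (Gauss-sum inversion with Gauss's sign, the Fourier series of `B₂`, oddness/reflection, and the
finite Bernoulli-sum identity applied to `c = (·/q)`), then linear bookkeeping with `mul_S_eq`.
[cite: Conrey2024CharacterSums, Thm. 4, Cor. 1 and Remark 1 (§2 p. 4; proof §4 p. 6)] -/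
theorem Conrey2024.fq_eq_finiteForm {q : ℕ} (hsq : Squarefree q) (hq4 : q % 4 = 3) {x : ℝ} (hx : 0 ≤ x) :
    Conrey2024.fq q x =
      2 * π ^ 2 * x / Real.sqrt q * (Conrey2024.S q (q / 2) - Conrey2024.S q (q * x)) := by
  have hq1 : 1 < q := by omega
  haveI : NeZero q := ⟨by omega⟩
  have hodd : Odd q := Nat.odd_iff.mpr (by omega)
  have hq0 : (q : ℝ) ≠ 0 := by positivity
  have hsqrt : Real.sqrt q ≠ 0 := (Real.sqrt_pos.mpr (by positivity)).ne'
  rw [fq_eq_sum_fract hsq hq4, sum_range_fract_eq hq4 hq1,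
    bernoulliSum_eq (c := fun n ↦ (J((n : ℤ) | q) : ℝ)) hodd (fun a ha ↦ jacobiSym_sub_eq_neg hq4 ha)
      jacobiSym_add_period hx]
  have hS := mul_S_eq (lt_trans zero_lt_one hq1) hx
  have hS2 : Conrey2024.S q (q / 2) =
      ∑ n ∈ Icc 1 ⌊(q : ℝ) / 2⌋₊, (J((n : ℤ) | q) : ℝ) * (1 - (n : ℝ) / ((q : ℝ) / 2)) := rfl
  rw [hS2]
  -- both sides are linear in the three finite sums
  have : 2 * π ^ 2 * x / Real.sqrt q *
      (∑ n ∈ Icc 1 ⌊(q : ℝ) / 2⌋₊, (J((n : ℤ) | q) : ℝ) * (1 - (n : ℝ) / ((q : ℝ) / 2)) -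
        Conrey2024.S q (q * x)) =
      2 * π ^ 2 / Real.sqrt q *
        (x * ∑ n ∈ Icc 1 ⌊(q : ℝ) / 2⌋₊, (J((n : ℤ) | q) : ℝ) * (1 - (n : ℝ) / ((q : ℝ) / 2)) -
          x * Conrey2024.S q (q * x)) := by
    field_simp
  rw [this, hS]
  field_simp
  ring

/-- **DISCHARGE of the named fact `Conrey2024_corollary1`** (Conrey 2024, Cor. 1: `q > 3` squarefree,
`q ≡ 3 (mod 8)`, `x ≥ 0`), by specialising `Conrey2024.fq_eq_finiteForm` (`q ≡ 3 (mod 8)` gives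
`q ≡ 3 (mod 4)`; the hypothesis `q > 3` is not needed). [cite: Conrey2024CharacterSums, Cor. 1 (§2 p. 4)] -/
theorem Conrey2024_corollary1_holds : Conrey2024_corollary1 := by
  intro q hsq hq8 _hq3 x hx
  exact Conrey2024.fq_eq_finiteForm hsq (by omega) hx

/-- **Proposition 1's dichotomy, now unconditional** (the base file's
`Conrey2024.fq_eq_zero_dichotomy` fed with `Conrey2024_corollary1_holds`): if `f_q(x) = 0` with
`x > 0` (`q > 3` squarefree, `q ≡ 3 (mod 8)`), then with `A = ∑_{n ≤ [qx]} (n/q)`,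
`B = ∑_{n ≤ [qx]} n (n/q)`, either `A = S_q(q/2)` and `B = 0`, or `A ≠ S_q(q/2)` and
`x = B/(q(A − S_q(q/2)))`. [cite: Conrey2024CharacterSums, Prop. 1 and the display following it (p. 10)] -/
theorem Conrey2024.fq_eq_zero_dichotomy' {q : ℕ} (hsq : Squarefree q) (hq8 : q % 8 = 3)
    (hq3 : 3 < q) {x : ℝ} (hx : 0 < x) (h0 : Conrey2024.fq q x = 0) :
    ((∑ n ∈ Finset.Icc 1 ⌊(q : ℝ) * x⌋₊, (jacobiSym (n : ℤ) q : ℝ)) = Conrey2024.S q (q / 2) ∧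
        (∑ n ∈ Finset.Icc 1 ⌊(q : ℝ) * x⌋₊, (n : ℝ) * (jacobiSym (n : ℤ) q : ℝ)) = 0) ∨
      ((∑ n ∈ Finset.Icc 1 ⌊(q : ℝ) * x⌋₊, (jacobiSym (n : ℤ) q : ℝ)) ≠ Conrey2024.S q (q / 2) ∧
        x = (∑ n ∈ Finset.Icc 1 ⌊(q : ℝ) * x⌋₊, (n : ℝ) * (jacobiSym (n : ℤ) q : ℝ)) /
          (q * ((∑ n ∈ Finset.Icc 1 ⌊(q : ℝ) * x⌋₊, (jacobiSym (n : ℤ) q : ℝ)) -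
            Conrey2024.S q (q / 2)))) :=
  Conrey2024.fq_eq_zero_dichotomy Conrey2024_corollary1_holds hsq hq8 hq3 hx h0

end Literature.NumberTheory.LFunctions

end
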